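import Mathlib.MeasureTheory.Group.FundamentalDomain
import Mathlib.MeasureTheory.Measure.Prod
import Mathlib.MeasureTheory.Integral.Bochner.ContinuousLinearMap
import HarnessLib

/-!
# Slices of a fundamental domain of a product lattice, and integration of functions of the second
# coordinate over it: `∫_{D} H(q) d(μ_P ⊗ μ_Q) = μ_P(T) · ∫_{𝓕_Q} H dμ_Q`
(Weil, *Basic Number Theory* (1967), Ch. IV §2 and Ch. V §4 — «the quotient measure of a product»;
Cassels–Fröhlich, *Algebraic Number Theory* (1967), Ch. II §17 (Tate's fundamental domains); Bourbaki,
*Intégration* VII §2 nos. 3–4, 10)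

Topic `MeasureTheory/Group`; namespace `Literature.MeasureTheory.Group`. KERNEL only (Mathlib-only imports):
proved theorems, no definition, no named fact, no instance, no `sorry`.

SETTING. `P, Q` commutative measurable groups with countable subgroups (lattices) `Λ_P ≤ P`, `Λ_Q ≤ Q` acting
by translation; `D ⊆ P × Q` a STRICT fundamental domain of `Λ_P × Λ_Q`, i.e.
`∀ z, ∃! (l, η) ∈ Λ_P × Λ_Q, (l + z.1, η + z.2) ∈ D` (`hD`), measurable (`hDm`). For `b ∈ Q` the **slice**
`T_b := {a ∈ P | ∃ η ∈ Λ_Q, (a, η + b) ∈ D}` (the part of `P` above the `Λ_Q`-orbit of `b`).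

* §1 `existsUnique_coe_add_mem_slice`, `isAddFundamentalDomain_slice`: EVERY SLICE `T_b` IS A FUNDAMENTAL
  DOMAIN OF `Λ_P` IN `P`; `measure_slice_eq`: for a `Λ_P`-invariant measure all slices have the same mass.
* §2 `lintegral_indicator_mul_comp_snd_eq`: for a `Λ_Q`-invariant measurable `H ≥ 0` on `Q`, a fundamental domain
  `𝓕_Q` of `Λ_Q` and invariant s-finite measures: `∫⁻ 1_D(z) H(z.2) d(μ_P ⊗ μ_Q) = μ_P(T_0) · ∫⁻_{𝓕_Q} H dμ_Q`
  (Tonelli, unfolding of `μ_Q` over `𝓕_Q`, `Σ_η μ_P{a | (a, η + q) ∈ D} = μ_P(T_q) = μ_P(T_0)`);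
  `prod_apply_fundamentalDomain_eq`: `(μ_P ⊗ μ_Q)(D) = μ_P(T_0) μ_Q(𝓕_Q)`.
* §3 `integral_eq_of_forall_lintegral_invariant_eq`: a GENERAL TRANSFER — if two measures give the same `[0,∞]`
  integral to every measurable `ℂ`-…, precisely to every measurable NON-NEGATIVE function invariant under a family of
  maps, they give the same Bochner integral to every invariant integrable `H : α → ℂ` (split `H` into
  `(Re H)^±, (Im H)^±`); §4 `setIntegral_comp_snd_eq`: the Bochner form of §2,
  `∫_{z ∈ D} H(z.2) d(μ_P ⊗ μ_Q) = μ_P(T_0) · ∫_{𝓕_Q} H dμ_Q` for `Λ_Q`-invariant `H` integrable on `𝓕_Q`.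

Used by the unipotent term of the LAW 5 road of `Cruxes/H413/Lines/F0_T1InnerFormTraceIdentity.lean` (cell
`pub/hodgecm-mathlib`, crux H413; Rogawski (1990) p. 97 «`∫_{U∖𝐔} Σ_{w ∈ E⁰} … = |α₃(m)|⁻¹ ψ(α₁(m)x)`»): with
`P × Q = 𝔸_E⁺ × 𝔸_E⁻ ≅ 𝔸_E`, `D` = Tate's domain, the integral over `E∖𝔸_E` of a function of the trace-zero part.

## References
* A. Weil, *Basic Number Theory* (1967), Ch. IV §2, Ch. V §4 [Weil1967].
* J. W. S. Cassels, A. Fröhlich (eds.), *Algebraic Number Theory* (1967), Ch. II §17 [CasselsFrohlichANT1967].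
* J. D. Rogawski, *Automorphic Representations of Unitary Groups in Three Variables* (1990), §7.3 (p. 97) [Rogawski1990].
-/

set_option autoImplicit false

noncomputable section

open MeasureTheory MeasureTheory.Measure Set Filter Function
open scoped ENNReal NNReal

namespace Literature.MeasureTheory.Group

/-! ## §1 The slices are fundamental domains of `Λ_P` -/

section Slices

variable {P Q : Type*} [AddCommGroup P] [AddCommGroup Q] (ΛP : AddSubgroup P) (ΛQ : AddSubgroup Q)
  {D : Set (P × Q)}

/-- **Unique representability in a slice**: if `D` is a strict fundamental domain of `Λ_P × Λ_Q`, then for all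
`b ∈ Q`, `a ∈ P` there is exactly one `l ∈ Λ_P` with `l + a ∈ T_b = {a' | ∃ η ∈ Λ_Q, (a', η + b) ∈ D}`.
[cite: Weil1967, Ch. IV §2] -/
theorem existsUnique_coe_add_mem_slice
    (hD : ∀ z : P × Q, ∃! l : ΛP × ΛQ, (((l.1 : P) + z.1, (l.2 : Q) + z.2) : P × Q) ∈ D) (b : Q) (a : P) :
    ∃! l : ΛP, ∃ η : ΛQ, (((l : P) + a, (η : Q) + b) : P × Q) ∈ D := by
  obtain ⟨l, hl, huniq⟩ := hD (a, b)
  refine ⟨l.1, ⟨l.2, hl⟩, fun l' hl' => ?_⟩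
  obtain ⟨η', h'⟩ := hl'
  exact congrArg Prod.fst (huniq (l', η') h')

/-- The `Λ_Q`-translates of a point meet `D` above at most one `η`: if `(a, η + b), (a, η' + b) ∈ D` then `η = η'`.
[cite: Weil1967, Ch. IV §2] -/
theorem eq_of_mem_of_mem
    (hD : ∀ z : P × Q, ∃! l : ΛP × ΛQ, (((l.1 : P) + z.1, (l.2 : Q) + z.2) : P × Q) ∈ D) {b : Q} {a : P}
    {η η' : ΛQ} (h : ((a, (η : Q) + b) : P × Q) ∈ D) (h' : ((a, (η' : Q) + b) : P × Q) ∈ D) : η = η' := by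
  obtain ⟨l, -, huniq⟩ := hD (a, b)
  have h₁ := huniq ((0 : ΛP), η) (by simpa only [ZeroMemClass.coe_zero, zero_add] using h)
  have h₂ := huniq ((0 : ΛP), η') (by simpa only [ZeroMemClass.coe_zero, zero_add] using h')
  exact (congrArg Prod.snd h₁).trans (congrArg Prod.snd h₂).symm

variable [MeasurableSpace P] [MeasurableSpace Q]

omit [AddCommGroup P] [MeasurableSpace P] [MeasurableSpace Q] in
/-- The slice is the countable union of the sections `{a | (a, η + b) ∈ D}`, `η ∈ Λ_Q`. [cite: Weil1967, Ch. IV §2] -/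
theorem slice_eq_iUnion (b : Q) :
    {a : P | ∃ η : ΛQ, ((a, (η : Q) + b) : P × Q) ∈ D} =
      ⋃ η : ΛQ, (fun a : P => ((a, (η : Q) + b) : P × Q)) ⁻¹' D := by
  ext a
  simp only [Set.mem_setOf_eq, Set.mem_iUnion, Set.mem_preimage]

omit [AddCommGroup P] in
/-- Slices of a measurable `D` are measurable (`Λ_Q` countable). [cite: Weil1967, Ch. IV §2] -/
theorem measurableSet_slice [Countable ΛQ] (hDm : MeasurableSet D) (b : Q) :
    MeasurableSet {a : P | ∃ η : ΛQ, ((a, (η : Q) + b) : P × Q) ∈ D} := by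
  rw [slice_eq_iUnion]
  exact MeasurableSet.iUnion fun η => (measurable_id.prodMk measurable_const) hDm

/-- **EVERY SLICE IS A FUNDAMENTAL DOMAIN OF `Λ_P`** (for any measure on `P`). [cite: Weil1967, Ch. IV §2]
[cite: CasselsFrohlichANT1967, Ch. II §17] -/
theorem isAddFundamentalDomain_slice [Countable ΛQ]
    (hD : ∀ z : P × Q, ∃! l : ΛP × ΛQ, (((l.1 : P) + z.1, (l.2 : Q) + z.2) : P × Q) ∈ D)
    (hDm : MeasurableSet D) (μP : Measure P) (b : Q) :
    IsAddFundamentalDomain ΛP {a : P | ∃ η : ΛQ, ((a, (η : Q) + b) : P × Q) ∈ D} μP := by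
  refine IsAddFundamentalDomain.mk' (measurableSet_slice ΛQ hDm b).nullMeasurableSet fun a => ?_
  simpa only [AddSubgroup.vadd_def, vadd_eq_add, Set.mem_setOf_eq] using existsUnique_coe_add_mem_slice ΛP ΛQ hD b a

/-- Translation by `Λ_P` is measurable on `P` (plumbing, stated as a theorem: no instance is declared).
[cite: Weil1967, Ch. IV §2] -/
theorem measurableConstVAdd_addSubgroup [MeasurableAdd P] : MeasurableConstVAdd ΛP P :=
  ⟨fun l => by
    have h : (fun x : P => l +ᵥ x) = fun x : P => (l : P) + x := funext fun x => by
      rw [AddSubgroup.vadd_def, vadd_eq_add]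
    rw [h]
    exact measurable_const_add (l : P)⟩

/-- A left-invariant measure on `P` is `Λ_P`-invariant (plumbing, no instance declared). [cite: Weil1967, Ch. IV §2] -/
theorem vaddInvariantMeasure_addSubgroup [MeasurableAdd P] (μP : Measure P) [μP.IsAddLeftInvariant] :
    VAddInvariantMeasure ΛP P μP :=
  ⟨fun l s _ => by
    have h : (fun x : P => l +ᵥ x) = fun x : P => (l : P) + x := funext fun x => by
      rw [AddSubgroup.vadd_def, vadd_eq_add]
    rw [h]
    exact measure_preimage_add μP (l : P) s⟩

/-- **All slices have the same mass** for a left-invariant measure on `P` (two fundamental domains of `Λ_P` have the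
same measure). [cite: Weil1967, Ch. IV §2] [cite: CasselsFrohlichANT1967, Ch. II §17] -/
theorem measure_slice_eq [MeasurableAdd P] [Countable ΛP] [Countable ΛQ]
    (hD : ∀ z : P × Q, ∃! l : ΛP × ΛQ, (((l.1 : P) + z.1, (l.2 : Q) + z.2) : P × Q) ∈ D)
    (hDm : MeasurableSet D) (μP : Measure P) [μP.IsAddLeftInvariant] (b b' : Q) :
    μP {a : P | ∃ η : ΛQ, ((a, (η : Q) + b) : P × Q) ∈ D} = μP {a : P | ∃ η : ΛQ, ((a, (η : Q) + b') : P × Q) ∈ D} := by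
  haveI := measurableConstVAdd_addSubgroup ΛP
  haveI := vaddInvariantMeasure_addSubgroup ΛP μP
  exact (isAddFundamentalDomain_slice ΛP ΛQ hD hDm μP b).measure_eq (isAddFundamentalDomain_slice ΛP ΛQ hD hDm μP b')

/-- **The slice is the disjoint union of its sections**: `μ_P(T_b) = Σ_{η ∈ Λ_Q} μ_P{a | (a, η + b) ∈ D}`.
[cite: Weil1967, Ch. IV §2] -/
theorem measure_slice_eq_tsum [Countable ΛQ]
    (hD : ∀ z : P × Q, ∃! l : ΛP × ΛQ, (((l.1 : P) + z.1, (l.2 : Q) + z.2) : P × Q) ∈ D)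
    (hDm : MeasurableSet D) (μP : Measure P) (b : Q) :
    μP {a : P | ∃ η : ΛQ, ((a, (η : Q) + b) : P × Q) ∈ D} =
      ∑' η : ΛQ, μP ((fun a : P => ((a, (η : Q) + b) : P × Q)) ⁻¹' D) := by
  rw [slice_eq_iUnion]
  refine measure_iUnion (fun η η' hne => ?_) fun η => (measurable_id.prodMk measurable_const) hDm
  refine Set.disjoint_left.2 fun a ha ha' => hne ?_
  exact eq_of_mem_of_mem ΛP ΛQ hD ha ha'

end Slices

/-! ## §2 Integration of a function of the second coordinate over `D` -/

section Integral

variable {P Q : Type*} [AddCommGroup P] [AddCommGroup Q] (ΛP : AddSubgroup P) (ΛQ : AddSubgroup Q)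
  {D : Set (P × Q)} [MeasurableSpace P] [MeasurableSpace Q] [MeasurableAdd P] [MeasurableAdd Q]
  [Countable ΛP] [Countable ΛQ]

/-- **`∫⁻ 1_D(z) H(z.2) d(μ_P ⊗ μ_Q) = μ_P(T_0) · ∫⁻_{𝓕_Q} H dμ_Q`** for a `Λ_Q`-invariant measurable `H ≥ 0`, a
fundamental domain `𝓕_Q` of `Λ_Q` in `Q`, and left-invariant s-finite measures `μ_P`, `μ_Q`.
[cite: Weil1967, Ch. V §4] [cite: CasselsFrohlichANT1967, Ch. II §17] -/
theorem lintegral_indicator_mul_comp_snd_eq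
    (hD : ∀ z : P × Q, ∃! l : ΛP × ΛQ, (((l.1 : P) + z.1, (l.2 : Q) + z.2) : P × Q) ∈ D)
    (hDm : MeasurableSet D) (μP : Measure P) [μP.IsAddLeftInvariant] [SFinite μP]
    (μQ : Measure Q) [μQ.IsAddLeftInvariant] [SFinite μQ]
    {𝓕Q : Set Q} (h𝓕 : IsAddFundamentalDomain ΛQ 𝓕Q μQ)
    {H : Q → ℝ≥0∞} (hH : Measurable H) (hHinv : ∀ (η : ΛQ) (q : Q), H ((η : Q) + q) = H q) :
    ∫⁻ z, D.indicator (1 : P × Q → ℝ≥0∞) z * H z.2 ∂(μP.prod μQ) =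
      μP {a : P | ∃ η : ΛQ, ((a, (η : Q) + (0 : Q)) : P × Q) ∈ D} * ∫⁻ q in 𝓕Q, H q ∂μQ := by
  haveI := measurableConstVAdd_addSubgroup ΛQ
  haveI := vaddInvariantMeasure_addSubgroup ΛQ μQ
  -- Tonelli, the first coordinate inside
  have hsec : ∀ q : Q, MeasurableSet ((fun a : P => ((a, q) : P × Q)) ⁻¹' D) := fun q =>
    (measurable_id.prodMk measurable_const) hDm
  have h1 : ∫⁻ z, D.indicator (1 : P × Q → ℝ≥0∞) z * H z.2 ∂(μP.prod μQ) =
      ∫⁻ q, H q * μP ((fun a : P => ((a, q) : P × Q)) ⁻¹' D) ∂μQ := by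
    have hm : Measurable fun z : P × Q => D.indicator (1 : P × Q → ℝ≥0∞) z * H z.2 :=
      (measurable_one.indicator hDm).mul (hH.comp measurable_snd)
    rw [lintegral_prod_symm _ hm.aemeasurable]
    refine lintegral_congr fun q => ?_
    have hpt : ∀ a : P, D.indicator (1 : P × Q → ℝ≥0∞) (a, q) * H q =
        ((fun a : P => ((a, q) : P × Q)) ⁻¹' D).indicator (fun _ => H q) a := by
      intro a
      by_cases ha : ((a, q) : P × Q) ∈ D
      · have ha' : a ∈ (fun a : P => ((a, q) : P × Q)) ⁻¹' D := ha
        rw [Set.indicator_of_mem ha, Set.indicator_of_mem ha', Pi.one_apply, one_mul]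
      · have ha' : a ∉ (fun a : P => ((a, q) : P × Q)) ⁻¹' D := ha
        rw [Set.indicator_of_notMem ha, Set.indicator_of_notMem ha', zero_mul]
    simp_rw [hpt]
    rw [lintegral_indicator (hsec q), setLIntegral_const]
  -- unfold `μ_Q` over `𝓕_Q`
  have h2 : ∫⁻ q, H q * μP ((fun a : P => ((a, q) : P × Q)) ⁻¹' D) ∂μQ =
      ∑' η : ΛQ, ∫⁻ q in 𝓕Q, H q * μP ((fun a : P => ((a, (η : Q) + q) : P × Q)) ⁻¹' D) ∂μQ := by
    rw [h𝓕.lintegral_eq_tsum'' (fun q => H q * μP ((fun a : P => ((a, q) : P × Q)) ⁻¹' D))]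
    refine tsum_congr fun η => ?_
    simp only [AddSubgroup.vadd_def, vadd_eq_add, hHinv]
  -- measurability of the sections' masses
  have hmeas : ∀ η : ΛQ, Measurable fun q : Q => μP ((fun a : P => ((a, (η : Q) + q) : P × Q)) ⁻¹' D) := fun η =>
    (measurable_measure_prodMk_right hDm).comp (measurable_const_add (η : Q))
  have h4 : ∑' η : ΛQ, ∫⁻ q in 𝓕Q, H q * μP ((fun a : P => ((a, (η : Q) + q) : P × Q)) ⁻¹' D) ∂μQ =
      ∫⁻ q in 𝓕Q, ∑' η : ΛQ, H q * μP ((fun a : P => ((a, (η : Q) + q) : P × Q)) ⁻¹' D) ∂μQ :=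
    (lintegral_tsum (μ := μQ.restrict 𝓕Q)
      (f := fun (η : ΛQ) (q : Q) => H q * μP ((fun a : P => ((a, (η : Q) + q) : P × Q)) ⁻¹' D))
      fun η => (hH.mul (hmeas η)).aemeasurable).symm
  rw [h1, h2, h4]
  have h3 : ∀ q : Q, ∑' η : ΛQ, H q * μP ((fun a : P => ((a, (η : Q) + q) : P × Q)) ⁻¹' D) =
      H q * μP {a : P | ∃ η : ΛQ, ((a, (η : Q) + (0 : Q)) : P × Q) ∈ D} := by
    intro q
    rw [ENNReal.tsum_mul_left, ← measure_slice_eq_tsum ΛP ΛQ hD hDm μP q,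
      measure_slice_eq ΛP ΛQ hD hDm μP q 0]
  simp_rw [h3]
  rw [lintegral_mul_const _ hH, mul_comm]

/-- **The mass of `D`**: `(μ_P ⊗ μ_Q)(D) = μ_P(T_0) · μ_Q(𝓕_Q)`. [cite: Weil1967, Ch. V §4] -/
theorem prod_apply_fundamentalDomain_eq
    (hD : ∀ z : P × Q, ∃! l : ΛP × ΛQ, (((l.1 : P) + z.1, (l.2 : Q) + z.2) : P × Q) ∈ D)
    (hDm : MeasurableSet D) (μP : Measure P) [μP.IsAddLeftInvariant] [SFinite μP]
    (μQ : Measure Q) [μQ.IsAddLeftInvariant] [SFinite μQ]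
    {𝓕Q : Set Q} (h𝓕 : IsAddFundamentalDomain ΛQ 𝓕Q μQ) :
    (μP.prod μQ) D = μP {a : P | ∃ η : ΛQ, ((a, (η : Q) + (0 : Q)) : P × Q) ∈ D} * μQ 𝓕Q := by
  have h := lintegral_indicator_mul_comp_snd_eq ΛP ΛQ hD hDm μP μQ h𝓕 (H := fun _ => 1) measurable_const
    (fun _ _ => rfl)
  simp only [mul_one, lintegral_indicator_one hDm, setLIntegral_const, one_mul] at h
  exact h

end Integral

/-! ## §3 From `[0, ∞]` identities on invariant functions to Bochner integrals -/

section Transfer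

variable {α : Type*} [MeasurableSpace α] {ι : Type*}

/-- **TRANSFER TO BOCHNER INTEGRALS.** Let `act : ι → α → α` be any family of maps and `ρ₁, ρ₂` measures on `α`
giving the same `[0, ∞]`-integral to every measurable `act`-invariant `f ≥ 0`. Then every measurable `act`-invariant
`H : α → ℂ` integrable for `ρ₁` is integrable for `ρ₂` and `∫ H dρ₁ = ∫ H dρ₂` (split `H = (Re H)⁺ − (Re H)⁻ +
i((Im H)⁺ − (Im H)⁻)`, each part invariant). [cite: Weil1967, Ch. V §4] -/
theorem integral_eq_of_forall_lintegral_invariant_eq (act : ι → α → α) {ρ₁ ρ₂ : Measure α}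
    (hagree : ∀ f : α → ℝ≥0∞, Measurable f → (∀ (i : ι) (x : α), f (act i x) = f x) →
      ∫⁻ x, f x ∂ρ₁ = ∫⁻ x, f x ∂ρ₂)
    {H : α → ℂ} (hHm : Measurable H) (hHinv : ∀ (i : ι) (x : α), H (act i x) = H x) (hint : Integrable H ρ₁) :
    Integrable H ρ₂ ∧ ∫ x, H x ∂ρ₁ = ∫ x, H x ∂ρ₂ := by
  have hint₂ : Integrable H ρ₂ := by
    refine ⟨hHm.aestronglyMeasurable, ?_⟩
    show ∫⁻ x, ‖H x‖ₑ ∂ρ₂ < ∞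
    rw [← hagree _ hHm.enorm (fun i x => by simp only [hHinv])]
    exact hint.2
  refine ⟨hint₂, ?_⟩
  have hre : Measurable fun x => RCLike.re (H x) := RCLike.continuous_re.measurable.comp hHm
  have him : Measurable fun x => RCLike.im (H x) := RCLike.continuous_im.measurable.comp hHm
  have e1 := hagree (fun x => ENNReal.ofReal (RCLike.re (H x))) hre.ennreal_ofReal
    (fun i x => by simp only [hHinv])
  have e2 := hagree (fun x => ENNReal.ofReal (-RCLike.re (H x))) hre.neg.ennreal_ofReal
    (fun i x => by simp only [hHinv])
  have e3 := hagree (fun x => ENNReal.ofReal (RCLike.im (H x))) him.ennreal_ofReal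
    (fun i x => by simp only [hHinv])
  have e4 := hagree (fun x => ENNReal.ofReal (-RCLike.im (H x))) him.neg.ennreal_ofReal
    (fun i x => by simp only [hHinv])
  rw [← integral_re_add_im hint, ← integral_re_add_im hint₂,
    integral_eq_lintegral_pos_part_sub_lintegral_neg_part hint.re,
    integral_eq_lintegral_pos_part_sub_lintegral_neg_part hint₂.re,
    integral_eq_lintegral_pos_part_sub_lintegral_neg_part hint.im,
    integral_eq_lintegral_pos_part_sub_lintegral_neg_part hint₂.im, e1, e2, e3, e4]

end Transfer

/-! ## §4 The Bochner form -/

section Bochner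

variable {P Q : Type*} [AddCommGroup P] [AddCommGroup Q] (ΛP : AddSubgroup P) (ΛQ : AddSubgroup Q)
  {D : Set (P × Q)} [MeasurableSpace P] [MeasurableSpace Q] [MeasurableAdd P] [MeasurableAdd Q]
  [Countable ΛP] [Countable ΛQ]

/-- **`∫_{z ∈ D} H(z.2) d(μ_P ⊗ μ_Q) = μ_P(T_0) · ∫_{𝓕_Q} H dμ_Q`** for a measurable `Λ_Q`-invariant `H : Q → ℂ`
integrable on the fundamental domain `𝓕_Q` (slices of finite mass); and `z ↦ H(z.2)` is integrable on `D`.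
[cite: Weil1967, Ch. V §4] [cite: Rogawski1990, §7.3 (p. 97)] -/
theorem integrableOn_and_setIntegral_comp_snd_eq
    (hD : ∀ z : P × Q, ∃! l : ΛP × ΛQ, (((l.1 : P) + z.1, (l.2 : Q) + z.2) : P × Q) ∈ D)
    (hDm : MeasurableSet D) (μP : Measure P) [μP.IsAddLeftInvariant] [SFinite μP]
    (μQ : Measure Q) [μQ.IsAddLeftInvariant] [SFinite μQ]
    {𝓕Q : Set Q} (h𝓕 : IsAddFundamentalDomain ΛQ 𝓕Q μQ)
    (hT : μP {a : P | ∃ η : ΛQ, ((a, (η : Q) + (0 : Q)) : P × Q) ∈ D} ≠ ∞)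
    {H : Q → ℂ} (hH : Measurable H) (hHinv : ∀ (η : ΛQ) (q : Q), H ((η : Q) + q) = H q)
    (hint : IntegrableOn H 𝓕Q μQ) :
    IntegrableOn (fun z : P × Q => H z.2) D (μP.prod μQ) ∧
      ∫ z in D, H z.2 ∂(μP.prod μQ) =
        (μP {a : P | ∃ η : ΛQ, ((a, (η : Q) + (0 : Q)) : P × Q) ∈ D}).toReal * ∫ q in 𝓕Q, H q ∂μQ := by
  set c : ℝ≥0∞ := μP {a : P | ∃ η : ΛQ, ((a, (η : Q) + (0 : Q)) : P × Q) ∈ D} with hc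
  -- the two measures on `Q` compared on `Λ_Q`-invariant functions
  set ρ₁ : Measure Q := c • μQ.restrict 𝓕Q with hρ₁
  set ρ₂ : Measure Q := Measure.map Prod.snd ((μP.prod μQ).restrict D) with hρ₂
  have hagree : ∀ f : Q → ℝ≥0∞, Measurable f → (∀ (η : ΛQ) (q : Q), f ((fun (η : ΛQ) (q : Q) => (η : Q) + q) η q) = f q) →
      ∫⁻ q, f q ∂ρ₁ = ∫⁻ q, f q ∂ρ₂ := by
    intro f hf hfinv
    rw [hρ₁, hρ₂, lintegral_smul_measure, lintegral_map hf measurable_snd, ← lintegral_indicator hDm, smul_eq_mul]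
    have hpt : ∀ z : P × Q, D.indicator (fun z : P × Q => f z.2) z = D.indicator (1 : P × Q → ℝ≥0∞) z * f z.2 := by
      intro z
      by_cases hz : z ∈ D
      · rw [Set.indicator_of_mem hz, Set.indicator_of_mem hz, Pi.one_apply, one_mul]
      · rw [Set.indicator_of_notMem hz, Set.indicator_of_notMem hz, zero_mul]
    simp_rw [hpt]
    rw [lintegral_indicator_mul_comp_snd_eq ΛP ΛQ hD hDm μP μQ h𝓕 hf hfinv]
  have hint₁ : Integrable H ρ₁ := by
    rw [hρ₁]
    exact hint.smul_measure hT
  obtain ⟨hint₂, heq⟩ := integral_eq_of_forall_lintegral_invariant_eq (fun (η : ΛQ) (q : Q) => (η : Q) + q) hagree hH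
    hHinv hint₁
  have hHm : AEStronglyMeasurable H (Measure.map Prod.snd ((μP.prod μQ).restrict D)) := hH.aestronglyMeasurable
  refine ⟨?_, ?_⟩
  · have h := (integrable_map_measure hHm measurable_snd.aemeasurable).1 (by rw [← hρ₂]; exact hint₂)
    exact h
  · have h2 : ∫ q, H q ∂ρ₂ = ∫ z in D, H z.2 ∂(μP.prod μQ) := by
      rw [hρ₂, integral_map measurable_snd.aemeasurable hHm]
    rw [← h2, ← heq, hρ₁, integral_smul_measure, Complex.real_smul]

end Bochner

end Literature.MeasureTheory.Group

end
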